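import Mathlib.AlgebraicGeometry.EllipticCurve.Affine.Point
import Mathlib.Algebra.Algebra.Rat
import Mathlib.NumberTheory.NumberField.Basic
import Mathlib.Algebra.Ring.Parity
import HarnessLib

/-!
# Points of `X(s3, b5)` over odd-degree extensions are controlled by those of `X₀(15)`
# (Yoshikawa 2022, Lemma 3.1 (1)–(2), Lemma 3.2, Corollary 3.3 (1))

Topic `Literature/NumberTheory/Automorphic`; companion of `TotallyRealModularityX0Fifteen.lean`
(Thorne 2019, Lemma 3 (2): over a cyclic totally real `F` with `√5 ∉ F`, `X₀(15)(F) = X₀(15)(ℚ)`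
and `X(s3,b5)(F) = X(s3,b5)(ℚ)` ⇒ every elliptic curve over `F` is modular) and of
`CaraianiNewtonModularityProofs.lean` (the models: `X₀(15) = X(b3,b5) ≅` Cremona 15A1
`[1, 1, 1, -10, -10]`, `X(s3,b5) ≅` 15A3 `[1, 1, 1, -5, 2]`, `cremona15a1_Δ`, `cremona15a3_Δ`).
Requested (ledger `wi-36844`) by route `Langlands/HeptagonalTower`, crux `OddDegreeDoor`
(stmt-Langlands-16840), which slaves the `X(s3,b5)`-hypothesis of Thorne's lemma to the
`X₀(15)`-hypothesis for fields of ODD degree.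

## Source (quoted from the held text `paper:arxiv-2206.12860`, pp. 4–5)

S. Yoshikawa, *Modularity of elliptic curves over cyclotomic `ℤ_p`-extensions of real quadratic
fields*, arXiv:2206.12860 (2022) [Yoshikawa2022], §3:
* **Lemma 3.1.** "(1) The modular curve `X₀(15)` (resp. `X(s3, b5)`) is isomorphic over `ℚ` to
  the elliptic curve with Cremona label 15A1 (resp. 15A3). (2) There is an isogeny
  `X(s3, b5) → X₀(15)` of degree 2 over `ℚ`." (Proof: "For (1), see [6, Lemma 5.6, Lemma 5.7]"
  = Freitas–Le Hung–Siksek 2015; "(2) is checked at LMFDB".)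
* **Lemma 3.2.** "Let `X, X'` be two smooth projective curves over a field `F` with a finite
  morphism `f : X' → X` of degree 2. Let `F'/F` be a finite extension of fields of odd degree. If
  `X(F') = X(F)`, then we have `X'(F') = X'(F)`." (Proof: for `P ∈ X'(F')`, `f(P) ∈ X(F)`, so `P`
  is defined over some `F''/F` with `[F'' : F] ≤ 2`; `[F' : F]` odd gives `F' ∩ F'' = F`.)
* **Corollary 3.3.** "Let `F'/F` be a finite extension of fields of characteristic 0 such that
  `[F' : F]` is odd. (1) If `X₀(15)(F') = X₀(15)(F)`, then `X(s3, b5)(F') = X(s3, b5)(F)`."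
  (Proof: "immediate consequence of Lemma 3.1 (2), (4), and Lemma 3.2.")

## Rendering

Cor. 3.3 (1) is vendored with the `ℚ`-models of Lemma 3.1 (1) substituted — Cremona's equations
15A1 `y² + xy + y = x³ + x² - 10x - 10` for `X₀(15)` and 15A3 `y² + xy + y = x³ + x² - 5x + 2`
for `X(s3, b5)` (literally the curves `Thorne2019.curveE1`, `Thorne2019.curveE2` of the companion
file and of Thorne 2019, Prop. 4; written here as anonymous-constructor literals so that this file
has no project imports): for fields `F ⊆ F'` of characteristic `0` with `[F' : F]` finite and odd,
"`X(F') = X(F)`" for a curve `X/ℚ` with a chosen `ℚ`-model `W` reads "every affine `F'`-point of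
`W ⊗ F'` has both coordinates in (the image of) `F`" (the point at infinity is rational; a
`ℚ`-isomorphism of models is a bijection on points preserving the field of definition, so the
choice of model is immaterial). A named fact (D-0014; users take
`(h : Yoshikawa2022_corollary3_3_1)`). It is dischargeable in principle — an explicit `2`-isogeny
15A3 → 15A1 over `ℚ` (Vélu; kernel one of the three rational `2`-torsion points of 15A3, whose
`x`-coordinates are `1, -3, 3/4`) and the degree argument of Lemma 3.2 (a root in `F'` of a
quadratic over `F` lies in `F` when `[F' : F]` is odd) — but that computation is not done here
(triage M). Part (2) of Cor. 3.3 (`X₀(21)`, `X(s3, b7)`) is not vendored (not requested).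

## References

* [Yoshikawa2022] S. Yoshikawa, arXiv:2206.12860, Lemma 3.1 (1)–(2), Lemma 3.2, Cor. 3.3 (1)
  (pp. 4–5 of the held text).
* [Thorne2019] J. A. Thorne, J. Eur. Math. Soc. 21 (2019), Prop. 4 (the same two models and the
  degree-`2` isogeny); [FreitasLeHungSiksek2015] Lemmas 5.6–5.7.
-/

noncomputable section

namespace Literature.NumberTheory.Automorphic

/-- **Yoshikawa (2022), Corollary 3.3 (1), on the Cremona models of Lemma 3.1 (1): over an
odd-degree extension `F'/F` of fields of characteristic `0`, if `X₀(15)` acquires no new points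
then neither does `X(s3, b5)`.** "Let `F'/F` be a finite extension of fields of characteristic 0
such that `[F' : F]` is odd. (1) If `X₀(15)(F') = X₀(15)(F)`, then `X(s3, b5)(F') = X(s3, b5)(F)`",
with "`X₀(15)` (resp. `X(s3, b5)`) is isomorphic over `ℚ` to the elliptic curve with Cremona label
15A1 (resp. 15A3)" (Lemma 3.1 (1)). Rendered (module docstring): for fields `F`, `F'` of
characteristic `0`, `F'` a finite-dimensional `F`-algebra of odd dimension, if every affine
`F'`-point of 15A1 `= ⟨1, 1, 1, -10, -10⟩` (`y² + xy + y = x³ + x² - 10x - 10`, base-changed to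
`F'`) has both coordinates in the image of `F`, then so does every affine `F'`-point of
15A3 `= ⟨1, 1, 1, -5, 2⟩` (`y² + xy + y = x³ + x² - 5x + 2`). A named fact (D-0014): users take
`(h : Yoshikawa2022_corollary3_3_1)`; dischargeable by an explicit `2`-isogeny and Lemma 3.2
(module docstring). [cite: Yoshikawa2022, Cor. 3.3 (1) with Lemma 3.1 (1)] -/
def Yoshikawa2022_corollary3_3_1 : Prop :=
  ∀ (F F' : Type) [Field F] [CharZero F] [Field F'] [CharZero F'] [Algebra F F']
    [FiniteDimensional F F'], Odd (Module.finrank F F') →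
    (∀ x y : F', ((⟨1, 1, 1, -10, -10⟩ : WeierstrassCurve ℚ).baseChange F').toAffine.Nonsingular
        x y → x ∈ Set.range (algebraMap F F') ∧ y ∈ Set.range (algebraMap F F')) →
    ∀ x y : F', ((⟨1, 1, 1, -5, 2⟩ : WeierstrassCurve ℚ).baseChange F').toAffine.Nonsingular
        x y → x ∈ Set.range (algebraMap F F') ∧ y ∈ Set.range (algebraMap F F')

/-- **The case `F = ℚ`** (the form route `Langlands/HeptagonalTower` consumes): for a number field
`K` of odd degree in which every point of 15A1 is rational, every point of 15A3 is rational, i.e.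
`X₀(15)(K) = X₀(15)(ℚ) ⇒ X(s3,b5)(K) = X(s3,b5)(ℚ)`. [cite: Yoshikawa2022, Cor. 3.3 (1)] -/
theorem Yoshikawa2022_corollary3_3_1.rat (h : Yoshikawa2022_corollary3_3_1) (K : Type) [Field K]
    [NumberField K] (hodd : Odd (Module.finrank ℚ K))
    (h1 : ∀ x y : K, ((⟨1, 1, 1, -10, -10⟩ : WeierstrassCurve ℚ).baseChange K).toAffine.Nonsingular
        x y → x ∈ Set.range (algebraMap ℚ K) ∧ y ∈ Set.range (algebraMap ℚ K))
    (x y : K) (hxy : ((⟨1, 1, 1, -5, 2⟩ : WeierstrassCurve ℚ).baseChange K).toAffine.Nonsingular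
        x y) : x ∈ Set.range (algebraMap ℚ K) ∧ y ∈ Set.range (algebraMap ℚ K) :=
  h ℚ K hodd h1 x y hxy

end Literature.NumberTheory.Automorphic

end
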